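import Literature.NumberTheory.Automorphic.UnitaryThreeAnisotropicStabilizerCosetCriterion   -- ★ FILE 2a (this seat): coset criterion; brings ★ FILE 1 + ★ Bounds + ★ (C′)
import HarnessLib

/-!
# The coset criterion of `Stab(w₀) ⧸ H′_m` in HERMITIAN-PLANE form: `hH′_m = h′H′_m ⟺ |s q′ − q s′| ≤ |ϖ^m| ∧ |D′·Φ(v′, v) − D| ≤ |ϖ^{2m+1}|`, the Lagrange identity, and the
# fibrewise invariant `D·Φ(v, v₀)` (Flicker 1998, Prop. 16 p. 96 — LAYER B′ step 2, FILE 2c)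

Topic `NumberTheory/Automorphic`; namespace `Literature.NumberTheory.Automorphic.UnitaryGroup`.  THEOREMS ONLY (no `def`, no instance, no notation, no named fact, no
`sorry`; count-neutral).  Cell `pub/hodgecm-mathlib`, F0∕P3a road «D-N7-inert», line «N7nsCount» ((F11-c) `stub_irredGValueNeg`); LAYER B′ FILE 2 remainder
(LEAD F0P3a-plan (g9) T8-92: cutting hand A-p13 (g30), design authority B-p10 (g24); plan posted 2026-09-01T06:18Z).  HONEST LABEL: HC_CM is proved only modulo the
printed citations until rung 0 closes; coordinates here, no count yet.

THE MATHEMATICS.  For `h ↔ (b, q, r, s) ∈ Stab(w₀)` put `v_h := (s, q) ∈ K²` and `Φ(v, w) := σv₁·w₁ + 4ϖ·σv₂·w₂` (the Gram form `diag(1, 4ϖ)` of the anisotropic plane);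
(U2) says `Φ(v_h, v_h) = 1`, and `D_h := det M_h = A s − 4ϖ q r = A∕σs` (★ FILE 1) satisfies `σD_h·D_h = 1`.  (§1) LAGRANGE: `Φ(a,b)Φ(c,d) − Φ(a,d)Φ(c,b) =
4ϖ·σ(a₁c₂ − a₂c₁)·(b₁d₂ − b₂d₁)`; hence `N(Φ(v,w)) + 4ϖ·N(v₁w₂ − v₂w₁) = 1` and `|Φ(v, w)| = 1` for unit vectors (★ `v_eq_one_and_v_le_one_of_norm_add`).  (§2) The second
expression of ★ FILE 2a IS `D_{h′}·Φ(v_{h′}, v_h) − D_h` (**`coset_expr_eq_det_mul_form_sub_det`**), so **`hH′_m = h′H′_m ⟺ |s q′ − q s′| ≤ |ϖ^m| ∧ |D′Φ(v′,v) − D| ≤ |ϖ^{2m+1}|`**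
(**`conj_mem_unitaryInt_iff_det_form`**).  (§3) FIBREWISE INVARIANT: if `v, v′, v₀` are pairwise `ϖ^m`-close unit vectors (`|v₁w₂ − v₂w₁| ≤ |ϖ^m|`) then
`|D′Φ(v′,v) − D| ≤ |ϖ^{2m+1}| ⟺ |D′Φ(v′,v₀) − DΦ(v,v₀)| ≤ |ϖ^{2m+1}|` (**`det_form_congr_iff_of_close`**; Lagrange + `|4ϖ·ϖ^m·ϖ^m| = |ϖ^{2m+1}|` + ultrametric) — on a
fibre of `[h] ↦ q∕s mod 𝔭^m` the class of `ι(h) := D_h·Φ(v_h, v₀) ∈ 𝒪_E^×` mod `𝔭^{2m+1}` is a complete invariant of the `H′_m`-coset (FILE 2d counts it).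

## References
* [Flicker1998UnitaryFL] Y. Z. Flicker, *Elementary proof of the fundamental lemma for a unitary group*, Canad. J. Math. 50 (1998), Prop. 4 p. 82, Prop. 16 p. 96.
* [Omeara1963] O. T. O'Meara, *Introduction to Quadratic Forms* (1963), §11 (principle of domination).
-/

set_option autoImplicit false

noncomputable section

open scoped MatrixGroups WithZero
open Matrix

namespace Literature.NumberTheory.Automorphic

namespace UnitaryGroup

open Literature.NumberTheory.Automorphic.HermitianLattice

variable {K : Type*} [Field K] [Valued K ℤᵐ⁰] {ϖ : K}
  (σ : K →+* K) {J : Matrix (Fin 3) (Fin 3) K} (hJ : J = (StdForm.antidiagonal 3).over K)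

/-! ## §1 The Lagrange identity for `Φ(v, w) = σv₁·w₁ + 4ϖ·σv₂·w₂`; `|Φ(v, w)| = 1` for unit vectors; `σD·D = 1` -/

omit [Valued K ℤᵐ⁰] in
/-- **LAGRANGE**: `Φ(a,b)Φ(c,d) − Φ(a,d)Φ(c,b) = 4ϖ·σ(a₁c₂ − a₂c₁)·(b₁d₂ − b₂d₁)` (`2 × 2` Cauchy–Binet for the Gram form `diag(1, 4ϖ)`). [cite: Omeara1963, §11] [cite: HornJohnson2013, §0.8.7 (Cauchy–Binet)] -/
theorem lagrange_form_identity (ϖ : K) (a₁ a₂ b₁ b₂ c₁ c₂ d₁ d₂ : K) :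
    (σ a₁ * b₁ + 4 * ϖ * (σ a₂ * b₂)) * (σ c₁ * d₁ + 4 * ϖ * (σ c₂ * d₂)) - (σ a₁ * d₁ + 4 * ϖ * (σ a₂ * d₂)) * (σ c₁ * b₁ + 4 * ϖ * (σ c₂ * b₂)) =
      4 * ϖ * (σ (a₁ * c₂ - a₂ * c₁) * (b₁ * d₂ - b₂ * d₁)) := by
  simp only [map_sub, map_mul]
  ring

omit [Valued K ℤᵐ⁰] in
/-- **`N(Φ(v, w)) + 4ϖ·N(v₁w₂ − v₂w₁) = Φ(v,v)·Φ(w,w)`** (Lagrange at `(a,b,c,d) = (v,w,w,v)`, `σ` an involution: `σΦ(v,w) = Φ(w,v)`). [cite: Omeara1963, §11] [cite: HornJohnson2013, §0.8.7 (Cauchy–Binet)] -/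
theorem norm_form_add_norm_det (hσσ : ∀ x, σ (σ x) = x) (hσϖ : σ ϖ = ϖ) (s q s' q' : K) :
    σ (σ s * s' + 4 * ϖ * (σ q * q')) * (σ s * s' + 4 * ϖ * (σ q * q')) + 4 * ϖ * (σ (s * q' - q * s') * (s * q' - q * s')) =
      (σ s * s + 4 * ϖ * (σ q * q)) * (σ s' * s' + 4 * ϖ * (σ q' * q')) := by
  simp only [map_add, map_mul, map_sub, map_ofNat, hσσ, hσϖ]
  ring

/-- **`|Φ(v, w)| = 1` for two UNIT vectors** (`Φ(v,v) = Φ(w,w) = 1`): `N(Φ(v,w)) + 4ϖ·N(δ) = 1` and ★ `v_eq_one_and_v_le_one_of_norm_add`; also `|v₁w₂ − v₂w₁| ≤ 1`.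
[cite: Omeara1963, §11] [cite: Flicker1998UnitaryFL, Prop. 16 p. 96] -/
theorem v_form_eq_one_of_unit (hd : LocalConjDatum σ ϖ) {s q s' q' : K} (hv : σ s * s + 4 * ϖ * (σ q * q) = 1) (hw : σ s' * s' + 4 * ϖ * (σ q' * q') = 1) :
    Valued.v (σ s * s' + 4 * ϖ * (σ q * q')) = 1 ∧ Valued.v (s * q' - q * s') ≤ 1 := by
  have h := norm_form_add_norm_det σ hd.σσ hd.σϖ s q s' q'
  rw [hv, hw, mul_one] at h
  exact v_eq_one_and_v_le_one_of_norm_add σ hd h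

include hJ in
/-- **`σ(D_h)·D_h = 1`** for `D_h = det M_h = A s − 4ϖ q r` (`D_h = A∕σs` ★ `det_stabilizerModel_eq`, `N(A) = N(s)` ★ `stabilizer_norm_A_eq_norm_s`).
[cite: Flicker1998UnitaryFL, Prop. 16 p. 96] -/
theorem map_det_mul_det_eq_one (hd : LocalConjDatum σ ϖ) {h : ↥(unitaryGroupOfForm σ J)} {b q r s : K}
    (hh : ((h : GL (Fin 3) K) : Matrix (Fin 3) (Fin 3) K) = !![1 + 2 * ϖ * b, q, b; 2 * ϖ * r, s, r; 4 * ϖ ^ 2 * b, 2 * ϖ * q, 1 + 2 * ϖ * b]) :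
    σ ((1 + 4 * ϖ * b) * s - 4 * ϖ * q * r) * ((1 + 4 * ϖ * b) * s - 4 * ϖ * q * r) = 1 := by
  obtain ⟨hs, -, -, -⟩ := stabilizer_valuation_bounds σ hJ hd hh
  have hs0 : s ≠ 0 := fun h0 => by rw [h0, map_zero] at hs; exact zero_ne_one hs
  have hσs : σ s ≠ 0 := fun h0 => hs0 (by have h := congrArg σ h0; rwa [hd.σσ, map_zero] at h)
  have hD : (1 + 4 * ϖ * b) * s - 4 * ϖ * q * r = (1 + 4 * ϖ * b) / σ s := by
    have h := det_stabilizerModel_eq σ hJ hd hh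
    rw [Matrix.det_fin_two_of] at h
    rw [← h]; ring
  have hN := stabilizer_norm_A_eq_norm_s σ hJ hd hh
  rw [hD, map_div₀, hd.σσ]
  field_simp
  linear_combination hN

/-! ## §2 The criterion in `(D, Φ)` form -/

include hJ in
/-- **The second congruence expression of ★ FILE 2a IS `D′·Φ(v′, v) − D`**: `s A′ − 4ϖ q r′ − D = D′·(σs′ s + 4ϖ σq′ q) − D` with `D′ = A′s′ − 4ϖq′r′ = A′∕σs′`
(`r′ = −A′σq′∕σs′`, (U2′)). [cite: Flicker1998UnitaryFL, Prop. 16 p. 96] -/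
theorem coset_expr_eq_det_mul_form_sub_det (hd : LocalConjDatum σ ϖ) {h' : ↥(unitaryGroupOfForm σ J)} {b' q' r' s' : K} (b q r s : K)
    (hh' : ((h' : GL (Fin 3) K) : Matrix (Fin 3) (Fin 3) K) = !![1 + 2 * ϖ * b', q', b'; 2 * ϖ * r', s', r'; 4 * ϖ ^ 2 * b', 2 * ϖ * q', 1 + 2 * ϖ * b']) :
    s * (1 + 4 * ϖ * b') - 4 * ϖ * q * r' - ((1 + 4 * ϖ * b) * s - 4 * ϖ * q * r) =
      ((1 + 4 * ϖ * b') * s' - 4 * ϖ * q' * r') * (σ s' * s + 4 * ϖ * (σ q' * q)) - ((1 + 4 * ϖ * b) * s - 4 * ϖ * q * r) := by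
  obtain ⟨hs', -, -, -⟩ := stabilizer_valuation_bounds σ hJ hd hh'
  have hs0 : s' ≠ 0 := fun h0 => by rw [h0, map_zero] at hs'; exact zero_ne_one hs'
  have hσs : σ s' ≠ 0 := fun h0 => hs0 (by have h := congrArg σ h0; rwa [hd.σσ, map_zero] at h)
  have hr' := stabilizer_r_eq σ hJ hd hh'
  have hD' : (1 + 4 * ϖ * b') * s' - 4 * ϖ * q' * r' = (1 + 4 * ϖ * b') / σ s' := by
    have h := det_stabilizerModel_eq σ hJ hd hh'
    rw [Matrix.det_fin_two_of] at h
    rw [← h]; ring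
  rw [hD', hr']
  field_simp
  ring

include hJ in
/-- **THE COSET CRITERION IN `(D, Φ)` FORM**: for `h, h′ ∈ Stab(w₀)`, `k = h⁻¹h′` (with coordinates, `h·k = h′`):
`d_m⁻¹ k d_m ∈ K₀ ⟺ |s q′ − q s′| ≤ |ϖ^m| ∧ |D′·Φ(v′, v) − D| ≤ |ϖ^{2m+1}|`. [cite: Flicker1998UnitaryFL, Prop. 16 p. 96] -/
theorem conj_mem_unitaryInt_iff_det_form (hd : LocalConjDatum σ ϖ) (m : ℕ) {d h k h' : ↥(unitaryGroupOfForm σ J)}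
    (hdm : ((d : GL (Fin 3) K) : Matrix (Fin 3) (Fin 3) K) = !![ϖ ^ m, 0, 0; 0, 1, 0; 0, 0, (ϖ ^ m)⁻¹]) {b q r s bk qk rk sk b' q' r' s' : K}
    (hh : ((h : GL (Fin 3) K) : Matrix (Fin 3) (Fin 3) K) = !![1 + 2 * ϖ * b, q, b; 2 * ϖ * r, s, r; 4 * ϖ ^ 2 * b, 2 * ϖ * q, 1 + 2 * ϖ * b])
    (hk : ((k : GL (Fin 3) K) : Matrix (Fin 3) (Fin 3) K) = !![1 + 2 * ϖ * bk, qk, bk; 2 * ϖ * rk, sk, rk; 4 * ϖ ^ 2 * bk, 2 * ϖ * qk, 1 + 2 * ϖ * bk])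
    (hh' : ((h' : GL (Fin 3) K) : Matrix (Fin 3) (Fin 3) K) = !![1 + 2 * ϖ * b', q', b'; 2 * ϖ * r', s', r'; 4 * ϖ ^ 2 * b', 2 * ϖ * q', 1 + 2 * ϖ * b'])
    (hhk : h * k = h') :
    d⁻¹ * k * d ∈ unitaryInt σ J ↔
      Valued.v (s * q' - q * s') ≤ Valued.v (ϖ ^ m) ∧
        Valued.v (((1 + 4 * ϖ * b') * s' - 4 * ϖ * q' * r') * (σ s' * s + 4 * ϖ * (σ q' * q)) - ((1 + 4 * ϖ * b) * s - 4 * ϖ * q * r)) ≤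
          Valued.v (ϖ ^ (2 * m + 1)) := by
  rw [conj_mem_unitaryInt_iff_of_mul_eq σ hJ hd m hdm hh hk hh' hhk, coset_expr_eq_det_mul_form_sub_det σ hJ hd b q r s hh']

/-! ## §3 The fibrewise invariant `D·Φ(v, v₀)` -/

/-- **TRANSFER ALONG A THIRD CLOSE UNIT VECTOR**: if `v = (s,q)`, `v₀ = (s₀,q₀)` are unit vectors and `v′ = (s′,q′)` any pair with `|s q′ − q s′| ≤ |ϖ^m|` and `|s q₀ − q s₀| ≤ |ϖ^m|`,
then `|D′Φ(v′,v) − D| ≤ |ϖ^{2m+1}| ⟺ |D′Φ(v′,v₀) − D·Φ(v,v₀)| ≤ |ϖ^{2m+1}|` for any `D, D′` with `|D′| ≤ 1` — multiply by the unit `Φ(v, v₀)` and use Lagrange: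
`Φ(v′,v)Φ(v,v₀) − Φ(v′,v₀) = 4ϖ·σ(s′q − q′s)·(s q₀ − q s₀)` has `|·| ≤ |ϖ^{2m+1}|`. [cite: Flicker1998UnitaryFL, Prop. 16 p. 96] [cite: Omeara1963, §11] -/
theorem det_form_congr_iff_of_close (hd : LocalConjDatum σ ϖ) (m : ℕ) {s q s' q' s₀ q₀ D D' : K}
    (hv : σ s * s + 4 * ϖ * (σ q * q) = 1) (hv₀ : σ s₀ * s₀ + 4 * ϖ * (σ q₀ * q₀) = 1)
    (hD' : Valued.v D' ≤ 1) (hclose : Valued.v (s * q' - q * s') ≤ Valued.v (ϖ ^ m)) (hclose₀ : Valued.v (s * q₀ - q * s₀) ≤ Valued.v (ϖ ^ m)) :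
    Valued.v (D' * (σ s' * s + 4 * ϖ * (σ q' * q)) - D) ≤ Valued.v (ϖ ^ (2 * m + 1)) ↔
      Valued.v (D' * (σ s' * s₀ + 4 * ϖ * (σ q' * q₀)) - D * (σ s * s₀ + 4 * ϖ * (σ q * q₀))) ≤ Valued.v (ϖ ^ (2 * m + 1)) := by
  obtain ⟨hΦ0, -⟩ := v_form_eq_one_of_unit σ hd hv hv₀
  -- Lagrange: `Φ(v′,v)·Φ(v,v₀) − Φ(v′,v₀)·Φ(v,v) = 4ϖ σ(s′q − q′s)(s q₀ − q s₀)`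
  have hL := lagrange_form_identity σ ϖ s' q' s q s q s₀ q₀
  rw [hv, mul_one] at hL
  -- the error term is small
  have h4 : Valued.v (4 : K) = 1 := by rw [show (4 : K) = 2 * 2 by norm_num, map_mul, hd.v2, one_mul]
  have herr : Valued.v (D' * (4 * ϖ * (σ (s' * q - q' * s) * (s * q₀ - q * s₀)))) ≤ Valued.v (ϖ ^ (2 * m + 1)) := by
    have hσδ : Valued.v (σ (s' * q - q' * s)) ≤ Valued.v (ϖ ^ m) := by
      rw [hd.vσ, show s' * q - q' * s = -(s * q' - q * s') by ring, Valuation.map_neg]; exact hclose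
    rw [map_mul, map_mul, map_mul, map_mul, h4, one_mul, show ϖ ^ (2 * m + 1) = ϖ * (ϖ ^ m * ϖ ^ m) by ring, map_mul, map_mul]
    calc Valued.v D' * (Valued.v ϖ * (Valued.v (σ (s' * q - q' * s)) * Valued.v (s * q₀ - q * s₀)))
        ≤ 1 * (Valued.v ϖ * (Valued.v (ϖ ^ m) * Valued.v (ϖ ^ m))) :=
          mul_le_mul' hD' (mul_le_mul' le_rfl (mul_le_mul' hσδ hclose₀))
      _ = Valued.v ϖ * (Valued.v (ϖ ^ m) * Valued.v (ϖ ^ m)) := one_mul _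
  -- multiply the first expression by the unit `Φ(v, v₀)`
  have key : (D' * (σ s' * s + 4 * ϖ * (σ q' * q)) - D) * (σ s * s₀ + 4 * ϖ * (σ q * q₀)) =
      (D' * (σ s' * s₀ + 4 * ϖ * (σ q' * q₀)) - D * (σ s * s₀ + 4 * ϖ * (σ q * q₀))) + D' * (4 * ϖ * (σ (s' * q - q' * s) * (s * q₀ - q * s₀))) := by
    linear_combination D' * hL
  have hmul : Valued.v (D' * (σ s' * s + 4 * ϖ * (σ q' * q)) - D) =
      Valued.v ((D' * (σ s' * s + 4 * ϖ * (σ q' * q)) - D) * (σ s * s₀ + 4 * ϖ * (σ q * q₀))) := by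
    rw [map_mul, hΦ0, mul_one]
  rw [hmul, key]
  constructor
  · intro h
    have h' := Valuation.map_sub Valued.v ((D' * (σ s' * s₀ + 4 * ϖ * (σ q' * q₀)) - D * (σ s * s₀ + 4 * ϖ * (σ q * q₀))) +
      D' * (4 * ϖ * (σ (s' * q - q' * s) * (s * q₀ - q * s₀)))) (D' * (4 * ϖ * (σ (s' * q - q' * s) * (s * q₀ - q * s₀))))
    rw [add_sub_cancel_right] at h'
    exact h'.trans (max_le h herr)
  · intro h
    exact (Valuation.map_add Valued.v _ _).trans (max_le h herr)

end UnitaryGroup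

end Literature.NumberTheory.Automorphic

end
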